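import Mathlib.NumberTheory.Padics.PadicVal.Basic
import Literature.NumberTheory.QuadraticForms.HasseMinkowskiBinaryRat
import Literature.NumberTheory.EllipticCurves.KubertTwoTwelve
import Literature.NumberTheory.EllipticCurves.TwoDescentRankBounds
import Literature.NumberTheory.EllipticCurves.MordellWeilRankZeroProofs
import HarnessLib

/-!
# The curve `24A1 = X₀(24)` has rank `0`: the complete `2`-descent over `ℚ`, carried out

Sibling of `Literature.NumberTheory.EllipticCurves.KubertTwoTwelve`, which reduces Kubert's theorem
"no `ℤ/2ℤ × ℤ/12ℤ` in `E(ℚ)`" (`Kubert1976_no_two_twelve`) to the named fact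
`Cremona1997_points_24A1`: the rational points of Cremona's curve
`24A1 : y² = x³ - x² - 4x + 4 = (x - 1)(x - 2)(x + 2)` are its eight torsion points (Cremona,
*Algorithms for Modular Elliptic Curves*, Table 1, `N = 24`, curve `A1`: `r = 0`, `|T| = 8`).
This file PROVES the first half of that table entry, **`r = 0`**, in the form

* `Literature.NumberTheory.EllipticCurves.Curve24A1.finite_point : Finite (24A1)(ℚ)`,

by the complete `2`-descent of Silverman, *AEC*, Prop. X.1.4 / Example X.1.5, using only
proved material of the tree: the `2`-descent homomorphism
`δ = (x - e₁, x - e₂) : E(ℚ) → ℚˣ/ℚˣ² × ℚˣ/ℚˣ²` with kernel `2E(ℚ)` (`TwoDescent.lean`), the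
Mordell–Weil theorem (`WeierstrassCurve.module_finite_point_holds`,
`MordellWeilTheoremProofs.lean`) and the counting lemma `2^(r+2) ≤ #δ(E(ℚ))`
(`pow_finrank_add_two_le_natCard_range`, `TwoDescentRankBounds.lean`). The second half
(`|T| = 8`, by reduction modulo `5` and `7`) and the discharge of `Cremona1997_points_24A1` and of
`Kubert1976_no_two_twelve` are in the sibling `KubertTwoTwelveProofs.lean`.

## The descent (all proved here; `e₁ = 1, e₂ = 2, e₃ = -2`)

For a rational point `(x, y)` with `y ≠ 0`:
1. `ord_p(x - 1)` is even for every prime `p ≠ 3` and `ord_p(x - 2)` is even for every prime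
   `p ≠ 2` (`even_padicValRat_sub`: if `ord_p(e₁ - e₂) = ord_p(e₁ - e₃) = 0` then `ord_p(x - e₁)`
   is even — the valuation-theoretic content of "the image of `δ` lies in `ℚ(S, 2)²`,
   `S = {2, 3, ∞}`", AEC Prop. X.1.4 / Thm. X.1.1(c));
2. hence `|x - 1| = u²` or `3u²` and `|x - 2| = v²` or `2v²` (`exists_abs_eq_sq_or`, through
   "a positive rational all of whose valuations are even is a square",
   `exists_eq_sq_of_even_padicValRat`, from the tree's
   `Literature.NumberTheory.QuadraticForms.isSquare_nat_of_forall_even_padicValNat`);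
3. `x - 1` and `x - 2` have the same sign (`y² = (x - 1)(x - 2)(x + 2) > 0`);
4. of the eight remaining pairs `(x - 1, x - 2) ≡ (±1 or ±3, ±1 or ±2)`, four are excluded by a
   `3`-adic obstruction on the corresponding homogeneous space, in the elementary form of an
   infinite descent modulo `3` on `αa² + βb² = 3γc²` (`eq_zero_of_sq_descent`):
   `u² + w² = 3`, `3u² - v² = 1`, `2w² - u² = 3`, `3w² + v² = 2` have no rational solutions;
5. so `δ(E(ℚ)) ⊆ {(1,1), (-3,-1), (-1,-2), (3,2)} = δ(torsion)` (`descentPair_mem`), a set of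
   `4 = #E(ℚ)[2]` classes, whence `2^(r+2) ≤ 4`, `r = 0`, and `E(ℚ)` is finite by Mordell–Weil
   and the structure theorem (`finite_point`, with `T₁ = (1, 0)` of order `2` and `Q = (0, 2)`
   of order `4`, `2Q = (2, 0)`, as the two torsion points separated by `δ`).

## References

* [SilvermanAEC2009] J. H. Silverman, *The Arithmetic of Elliptic Curves*, 2nd ed., GTM 106,
  Springer 2009: Prop. X.1.4 (complete `2`-descent) and Example X.1.5; Thm. VIII.6.7.
* [CremonaAlgorithms1997] J. E. Cremona, *Algorithms for Modular Elliptic Curves*, 2nd ed., CUP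
  1997: Table 1, `N = 24`, curve `A1 = [0, -1, 0, -4, 4]`, `r = 0`, `|T| = 8`; §3.6 (descent).
* [Knapp1993] A. W. Knapp, *Elliptic Curves*, Princeton 1992, Thm. 4.2 and §IV.3.

## Design

* Theorems only (no definitions, no new facts). Statements about points avoid the group law
  or are polymorphic in the `DecidableEq ℚ` instance; inside proofs the group law on `E(ℚ)` is
  elaborated against the classical instance (`letI := Classical.decEq ℚ`), which is the
  instance carried by the general-field theorems of `MordellWeilTheoremProofs.lean` and
  `TwoDescentRankBounds.lean`.
* Helper lemmas in `namespace Literature.NumberTheory.EllipticCurves.Curve24A1` (grouping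
  sub-namespace named after the curve).
-/

noncomputable section

open WeierstrassCurve WeierstrassCurve.Affine WeierstrassCurve.Affine.Point

namespace Literature.NumberTheory.EllipticCurves

namespace Curve24A1

/-! ### Arithmetic of `ℚ`: parities of valuations, squares, and a descent modulo `3` -/

/-- **Parity of `ord_p(x - e₁)` on `y² = (x - e₁)(x - e₂)(x - e₃)`** (the valuation-theoretic
content of Silverman, *AEC*, Prop. X.1.4, "image in `K(S,2) × K(S,2)`", at a prime `p ∉ S`): if
`e₁ ≠ e₂`, `e₁ ≠ e₃`, `ord_p(e₁ - e₂) = ord_p(e₁ - e₃) = 0`, `y ≠ 0` and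
`y² = (x - e₁)(x - e₂)(x - e₃)`, then `ord_p(x - e₁)` is even. Proof: if `ord_p(x - e₁) < 0`
then all three factors have that valuation and `3 ord = 2 ord y`; if `ord_p(x - e₁) > 0` then
the other two factors are units and `ord_p(x - e₁) = 2 ord_p y`.
[cite: SilvermanAEC2009, Prop. X.1.4] -/
theorem even_padicValRat_sub (p : ℕ) [Fact p.Prime] {e₁ e₂ e₃ x y : ℚ} (h₁₂ : e₁ ≠ e₂)
    (h₁₃ : e₁ ≠ e₃) (hv₁₂ : padicValRat p (e₁ - e₂) = 0) (hv₁₃ : padicValRat p (e₁ - e₃) = 0)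
    (hy : y ≠ 0) (h : y ^ 2 = (x - e₁) * (x - e₂) * (x - e₃)) :
    Even (padicValRat p (x - e₁)) := by
  have h₀ : (x - e₁) * (x - e₂) * (x - e₃) ≠ 0 := h ▸ pow_ne_zero 2 hy
  have hx₁ : x - e₁ ≠ 0 := fun h0 => h₀ (by rw [h0, zero_mul, zero_mul])
  have hx₂ : x - e₂ ≠ 0 := fun h0 => h₀ (by rw [h0, mul_zero, zero_mul])
  have hx₃ : x - e₃ ≠ 0 := fun h0 => h₀ (by rw [h0, mul_zero])
  have he₁₂ : e₁ - e₂ ≠ 0 := sub_ne_zero.mpr h₁₂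
  have he₁₃ : e₁ - e₃ ≠ 0 := sub_ne_zero.mpr h₁₃
  have hsum : 2 * padicValRat p y =
      padicValRat p (x - e₁) + padicValRat p (x - e₂) + padicValRat p (x - e₃) := by
    have key := congrArg (padicValRat p) h
    rw [padicValRat.pow, padicValRat.mul (mul_ne_zero hx₁ hx₂) hx₃, padicValRat.mul hx₁ hx₂]
      at key
    exact_mod_cast key
  have hx₂' : x - e₂ = (x - e₁) + (e₁ - e₂) := by ring
  have hx₃' : x - e₃ = (x - e₁) + (e₁ - e₃) := by ring
  have hx₂'' : (x - e₁) + (e₁ - e₂) ≠ 0 := hx₂' ▸ hx₂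
  have hx₃'' : (x - e₁) + (e₁ - e₃) ≠ 0 := hx₃' ▸ hx₃
  rcases lt_trichotomy (padicValRat p (x - e₁)) 0 with hlt | heq | hgt
  · have hv₂ : padicValRat p (x - e₂) = padicValRat p (x - e₁) := by
      rw [hx₂']
      exact padicValRat.add_eq_of_lt hx₂'' hx₁ he₁₂ (by rw [hv₁₂]; exact hlt)
    have hv₃ : padicValRat p (x - e₃) = padicValRat p (x - e₁) := by
      rw [hx₃']
      exact padicValRat.add_eq_of_lt hx₃'' hx₁ he₁₃ (by rw [hv₁₃]; exact hlt)
    rw [hv₂, hv₃] at hsum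
    exact ⟨padicValRat p y - padicValRat p (x - e₁), by omega⟩
  · exact ⟨0, by rw [heq]; rfl⟩
  · have hv₂ : padicValRat p (x - e₂) = 0 := by
      rw [hx₂', add_comm, padicValRat.add_eq_of_lt (by rwa [add_comm]) he₁₂ hx₁
        (by rw [hv₁₂]; exact hgt), hv₁₂]
    have hv₃ : padicValRat p (x - e₃) = 0 := by
      rw [hx₃', add_comm, padicValRat.add_eq_of_lt (by rwa [add_comm]) he₁₃ hx₁
        (by rw [hv₁₃]; exact hgt), hv₁₃]
    rw [hv₂, hv₃] at hsum
    exact ⟨padicValRat p y, by omega⟩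

/-- **A positive rational all of whose `p`-adic valuations are even is a square** (unique
factorisation: `r = ∏ p^{v_p(r)} = (∏ p^{v_p(r)/2})²`; used implicitly in Silverman, *AEC*,
Example X.1.5). Proof: `N = |num r| · den r` has even valuations, hence is a square
(`Literature.NumberTheory.QuadraticForms.isSquare_nat_of_forall_even_padicValNat`), and
`r = N / (den r)²`. [folklore] -/
theorem exists_eq_sq_of_even_padicValRat {r : ℚ} (hr : 0 < r)
    (h : ∀ p : ℕ, p.Prime → Even (padicValRat p r)) : ∃ u : ℚ, r = u ^ 2 := by
  have hnum : 0 < r.num := Rat.num_pos.mpr hr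
  have hnum0 : r.num.natAbs ≠ 0 := Int.natAbs_ne_zero.mpr hnum.ne'
  set N : ℕ := r.num.natAbs * r.den with hN
  have hN0 : N ≠ 0 := mul_ne_zero hnum0 r.den_nz
  have hsq : IsSquare N := by
    refine Literature.NumberTheory.QuadraticForms.isSquare_nat_of_forall_even_padicValNat hN0
      fun p hp => ?_
    haveI := Fact.mk hp
    obtain ⟨k, hk⟩ := h p hp
    have hdef : padicValRat p r = (padicValNat p r.num.natAbs : ℤ) - padicValNat p r.den := rfl
    rw [hN, padicValNat.mul hnum0 r.den_nz]
    refine ⟨(k + padicValNat p r.den).toNat, ?_⟩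
    omega
  obtain ⟨m, hm⟩ := hsq
  have hNQ : (N : ℚ) = r * (r.den : ℚ) ^ 2 := by
    have h1 : ((r.num.natAbs : ℕ) : ℚ) = r.num := by
      rw [← Int.cast_natCast, Int.natAbs_of_nonneg hnum.le]
    rw [hN, Nat.cast_mul, h1, ← Rat.mul_den_eq_num r]
    ring
  have hden : (r.den : ℚ) ≠ 0 := Nat.cast_ne_zero.mpr r.den_nz
  refine ⟨m / r.den, ?_⟩
  rw [div_pow, eq_div_iff (pow_ne_zero 2 hden), ← hNQ, hm, Nat.cast_mul, sq]

/-- **From even valuations away from `q` to a square class in `{1, q}`**: if `r ≠ 0` and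
`ord_p(r)` is even for every prime `p ≠ q`, then `|r| = u²` or `|r| = q u²` for some rational `u`
(according to the parity of `ord_q(r)`). This is the step "`b ∈ ℚ(S, 2)` is represented by
`±∏_{p ∈ S} p^{ε_p}`" of Silverman, *AEC*, Example X.1.5, for `S ∋ q`. [folklore] -/
theorem exists_abs_eq_sq_or {r : ℚ} (hr : r ≠ 0) (q : ℕ) [hq : Fact q.Prime]
    (h : ∀ p : ℕ, p.Prime → p ≠ q → Even (padicValRat p r)) :
    ∃ u : ℚ, |r| = u ^ 2 ∨ |r| = q * u ^ 2 := by
  have habs : ∀ p, padicValRat p |r| = padicValRat p r := fun p => by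
    rcases abs_choice r with h' | h' <;> rw [h']
    exact padicValRat.neg r
  have hpos : 0 < |r| := abs_pos.mpr hr
  have hr' : |r| ≠ 0 := abs_ne_zero.mpr hr
  by_cases hev : Even (padicValRat q r)
  · obtain ⟨u, hu⟩ := exists_eq_sq_of_even_padicValRat hpos fun p hp => by
      rw [habs]
      by_cases hpq : p = q
      · subst hpq; exact hev
      · exact h p hp hpq
    exact ⟨u, Or.inl hu⟩
  · have hq0 : (q : ℚ) ≠ 0 := Nat.cast_ne_zero.mpr hq.out.ne_zero
    have hqpos : (0 : ℚ) < q := by exact_mod_cast hq.out.pos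
    obtain ⟨u, hu⟩ := exists_eq_sq_of_even_padicValRat (div_pos hpos hqpos) fun p hp => by
      haveI := Fact.mk hp
      rw [padicValRat.div hr' hq0, habs, padicValRat.of_nat]
      by_cases hpq : p = q
      · subst hpq
        rw [padicValNat_self, Nat.cast_one]
        rw [Int.not_even_iff_odd] at hev
        obtain ⟨k, hk⟩ := hev
        exact ⟨k, by omega⟩
      · rw [padicValNat_primes hpq, Nat.cast_zero, sub_zero]
        exact h p hp hpq
    refine ⟨u, Or.inr ?_⟩
    rw [← hu, mul_div_cancel₀ _ hq0]

/-- **Lifting a congruence modulo `3`**: if the binary form `αa² + βb²` is anisotropic modulo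
`3` (hypothesis `H`, decidable for numerical `α, β`), then `3 ∣ αa² + βb²` forces `3 ∣ a` and
`3 ∣ b`. [folklore] -/
theorem three_dvd_of_zmod {α β : ℤ}
    (H : ∀ a b : ZMod 3, (α : ZMod 3) * a ^ 2 + (β : ZMod 3) * b ^ 2 = 0 → a = 0 ∧ b = 0)
    {a b : ℤ} (h : (3 : ℤ) ∣ α * a ^ 2 + β * b ^ 2) : (3 : ℤ) ∣ a ∧ (3 : ℤ) ∣ b := by
  have h' : (α : ZMod 3) * (a : ZMod 3) ^ 2 + (β : ZMod 3) * (b : ZMod 3) ^ 2 = 0 := by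
    have := (ZMod.intCast_zmod_eq_zero_iff_dvd _ 3).mpr h
    push_cast at this
    exact this
  obtain ⟨ha, hb⟩ := H _ _ h'
  exact ⟨(ZMod.intCast_zmod_eq_zero_iff_dvd a 3).mp ha,
    (ZMod.intCast_zmod_eq_zero_iff_dvd b 3).mp hb⟩

/-- **Infinite descent modulo `3`** (the `3`-adic local obstruction of the `2`-descent, in
Fermat's form): if `αa² + βb²` is anisotropic modulo `3` and `3 ∤ γ`, then the only integer
solution of `αa² + βb² = 3γc²` is `a = b = c = 0`. Proof: modulo `3`, `3 ∣ a, b`; then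
`9 ∣ 3γc²` gives `3 ∣ c`, and `(a/3, b/3, c/3)` is a smaller solution. [folklore] -/
theorem eq_zero_of_sq_descent {α β γ : ℤ}
    (H : ∀ a b : ZMod 3, (α : ZMod 3) * a ^ 2 + (β : ZMod 3) * b ^ 2 = 0 → a = 0 ∧ b = 0)
    (hγ : ¬(3 : ℤ) ∣ γ) {a b c : ℤ} (h : α * a ^ 2 + β * b ^ 2 = 3 * γ * c ^ 2) :
    a = 0 ∧ b = 0 ∧ c = 0 := by
  suffices key : ∀ (n : ℕ) (a b c : ℤ), a.natAbs + b.natAbs + c.natAbs ≤ n →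
      α * a ^ 2 + β * b ^ 2 = 3 * γ * c ^ 2 → a = 0 ∧ b = 0 ∧ c = 0 from
    key _ a b c le_rfl h
  intro n
  induction n with
  | zero =>
    intro a b c hn _
    omega
  | succ n ih =>
    intro a b c hn h
    obtain ⟨⟨a', rfl⟩, ⟨b', rfl⟩⟩ :=
      three_dvd_of_zmod H (a := a) (b := b) ⟨γ * c ^ 2, by rw [h]; ring⟩
    have h3 : γ * c ^ 2 = 3 * (α * a' ^ 2 + β * b' ^ 2) := by
      have : (3 : ℤ) * (γ * c ^ 2) = 3 * (3 * (α * a' ^ 2 + β * b' ^ 2)) := by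
        linear_combination h.symm
      exact mul_left_cancel₀ three_ne_zero this
    have h3c : (3 : ℤ) ∣ c := by
      have h9 : (3 : ℤ) ∣ γ * c ^ 2 := ⟨_, h3⟩
      rcases Int.prime_three.dvd_or_dvd h9 with h3' | h3'
      · exact absurd h3' hγ
      · exact Int.prime_three.dvd_of_dvd_pow h3'
    obtain ⟨c', rfl⟩ := h3c
    have h' : α * a' ^ 2 + β * b' ^ 2 = 3 * γ * c' ^ 2 := by
      have : (3 : ℤ) * (α * a' ^ 2 + β * b' ^ 2) = 3 * (3 * γ * c' ^ 2) := by
        linear_combination h3.symm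
      exact mul_left_cancel₀ three_ne_zero this
    by_cases h0 : a' = 0 ∧ b' = 0 ∧ c' = 0
    · obtain ⟨rfl, rfl, rfl⟩ := h0
      simp
    · simp only [Int.natAbs_mul] at hn
      have h3abs : (3 : ℤ).natAbs = 3 := rfl
      rw [h3abs] at hn
      exact absurd (ih a' b' c' (by omega) h') h0

/-- **The rational form of the descent**: under the same hypotheses, `αa² + βb² = 3γc²` has no
rational solution other than `a = b = c = 0` (clear denominators). [folklore] -/
theorem eq_zero_of_sq_descent_rat {α β γ : ℤ}
    (H : ∀ a b : ZMod 3, (α : ZMod 3) * a ^ 2 + (β : ZMod 3) * b ^ 2 = 0 → a = 0 ∧ b = 0)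
    (hγ : ¬(3 : ℤ) ∣ γ) {a b c : ℚ} (h : (α : ℚ) * a ^ 2 + β * b ^ 2 = 3 * γ * c ^ 2) :
    a = 0 ∧ b = 0 ∧ c = 0 := by
  set D : ℚ := (a.den : ℚ) * b.den * c.den with hD
  have hD0 : D ≠ 0 := by rw [hD]; positivity
  have ha : a * D = ((a.num * b.den * c.den : ℤ) : ℚ) := by
    push_cast; rw [hD, ← Rat.mul_den_eq_num a]; ring
  have hb : b * D = ((b.num * a.den * c.den : ℤ) : ℚ) := by
    push_cast; rw [hD, ← Rat.mul_den_eq_num b]; ring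
  have hc : c * D = ((c.num * a.den * b.den : ℤ) : ℚ) := by
    push_cast; rw [hD, ← Rat.mul_den_eq_num c]; ring
  have key : (α : ℚ) * (a * D) ^ 2 + β * (b * D) ^ 2 = 3 * γ * (c * D) ^ 2 := by
    linear_combination D ^ 2 * h
  rw [ha, hb, hc] at key
  have key' : α * (a.num * b.den * c.den) ^ 2 + β * (b.num * a.den * c.den) ^ 2 =
      3 * γ * (c.num * a.den * b.den) ^ 2 := by
    exact_mod_cast key
  obtain ⟨h1, h2, h3⟩ := eq_zero_of_sq_descent H hγ key'
  refine ⟨?_, ?_, ?_⟩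
  · have : a * D = 0 := by rw [ha, h1, Int.cast_zero]
    exact (mul_eq_zero.mp this).resolve_right hD0
  · have : b * D = 0 := by rw [hb, h2, Int.cast_zero]
    exact (mul_eq_zero.mp this).resolve_right hD0
  · have : c * D = 0 := by rw [hc, h3, Int.cast_zero]
    exact (mul_eq_zero.mp this).resolve_right hD0

/-- `2` is not the square of a rational number (`ord₂ 2 = 1` is odd). [folklore] -/
theorem two_ne_sq (u : ℚ) : (2 : ℚ) ≠ u ^ 2 := by
  intro h
  have key := congrArg (padicValRat 2) h
  rw [padicValRat.pow, show (2 : ℚ) = ((2 : ℕ) : ℚ) by norm_num, padicValRat.of_nat,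
    padicValNat_self] at key
  omega

/-! ### The curve `24A1`: rational `2`-torsion `1, 2, -2` and the values of the `2`-descent -/

/-- `24A1 : y² = x³ - x² - 4x + 4` has rational `2`-torsion with `e₁ = 1, e₂ = 2, e₃ = -2`
(`b₂ = -4 = -4Σeᵢ`, `b₄ = -8 = 2Σeᵢeⱼ`, `b₆ = 16 = -4e₁e₂e₃`), the hypothesis
`SplitTwoTorsion` of the tree's complete `2`-descent. Cremona, Table 1, `24A1` (`|T| = 8`, so
`E[2] ⊆ E(ℚ)`). [cite: CremonaAlgorithms1997, Table 1, N = 24, curve A1] -/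
theorem splitTwoTorsion : curve24A1.toAffine.SplitTwoTorsion 1 2 (-2) := by
  refine ⟨?_, ?_, ?_⟩ <;> norm_num [curve24A1, b₂, b₄, b₆]

/-- On `24A1`, `y² = (x - 1)(x - 2)(x - (-2))`. [cite: CremonaAlgorithms1997, Table 1, N = 24, curve A1] -/
theorem sq_eq_of_equation {x y : ℚ} (h : curve24A1.toAffine.Equation x y) :
    y ^ 2 = (x - 1) * (x - 2) * (x - (-2)) := by
  rw [equation_curve24A1_iff] at h
  linear_combination h

/-- An affine point of `24A1` with `y = 0` is one of the three `2`-torsion points `x ∈ {1, 2, -2}`.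
[cite: CremonaAlgorithms1997, Table 1, N = 24, curve A1] -/
theorem x_eq_of_y_eq_zero {x y : ℚ} (h : curve24A1.toAffine.Equation x y) (hy : y = 0) :
    x = 1 ∨ x = 2 ∨ x = -2 := by
  have hE := sq_eq_of_equation h
  rw [hy, zero_pow two_ne_zero, zero_eq_mul, mul_eq_zero] at hE
  rcases hE with (hE | hE) | hE
  · exact Or.inl (by linarith)
  · exact Or.inr (Or.inl (by linarith))
  · exact Or.inr (Or.inr (by linarith))

/-- **The `2`-descent on `24A1`, arithmetic core** (Silverman, *AEC*, Example X.1.5 carried out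
for `y² = (x - 1)(x - 2)(x + 2)`, `S = {2, 3, ∞}`): for a rational point `(x, y)` with `y ≠ 0`
there are non-zero rationals `u, v` with
`(x - 1, x - 2) ∈ {(u², v²), (-3u², -v²), (-u², -2v²), (3u², 2v²)}`.
Proof: by `even_padicValRat_sub` at `e₁ = 1` (`ord_p(1 - 2) = 0`, `ord_p(1 + 2) = 0` for
`p ≠ 3`) and at `e₁ = 2` (`ord_p(2 - 1) = 0`, `ord_p(2 + 2) = 0` for `p ≠ 2`),
`|x - 1| ∈ {u², 3u²}` and `|x - 2| ∈ {v², 2v²}` (`exists_abs_eq_sq_or`); `x - 1`, `x - 2` have the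
same sign since `y² > 0`; and the four pairs `(-u², -v²)`, `(3u², v²)`, `(u², 2v²)`,
`(-3u², -2v²)` lead, with `x + 2 = y²/((x - 1)(x - 2))`, to `w² + u² = 3`, `v² + 1 = 3u²`,
`2w² - u² = 3`, `v² - 2 = -3w²`, each impossible by the descent modulo `3`
(`eq_zero_of_sq_descent_rat`). [cite: SilvermanAEC2009, Example X.1.5 (method)] -/
theorem exists_eq_mul_sq_of_equation {x y : ℚ} (h : curve24A1.toAffine.Equation x y)
    (hy : y ≠ 0) :
    ∃ u v : ℚ, u ≠ 0 ∧ v ≠ 0 ∧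
      ((x - 1 = u ^ 2 ∧ x - 2 = v ^ 2) ∨ (x - 1 = -3 * u ^ 2 ∧ x - 2 = -v ^ 2) ∨
        (x - 1 = -u ^ 2 ∧ x - 2 = -2 * v ^ 2) ∨ (x - 1 = 3 * u ^ 2 ∧ x - 2 = 2 * v ^ 2)) := by
  have hE := sq_eq_of_equation h
  have hE' : y ^ 2 = (x - 2) * (x - 1) * (x - (-2)) := by rw [hE]; ring
  have h₀ : (x - 1) * (x - 2) * (x - (-2)) ≠ 0 := hE ▸ pow_ne_zero 2 hy
  have hx₁ : x - 1 ≠ 0 := fun h0 => h₀ (by rw [h0, zero_mul, zero_mul])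
  have hx₂ : x - 2 ≠ 0 := fun h0 => h₀ (by rw [h0, mul_zero, zero_mul])
  -- parities of valuations
  have P1 : ∀ p : ℕ, p.Prime → p ≠ 3 → Even (padicValRat p (x - 1)) := fun p hp hp3 => by
    haveI := Fact.mk hp
    refine even_padicValRat_sub p (by norm_num) (by norm_num) ?_ ?_ hy hE
    · rw [show (1 : ℚ) - 2 = -1 by norm_num, padicValRat.neg, padicValRat.one]
    · rw [show (1 : ℚ) - (-2) = ((3 : ℕ) : ℚ) by norm_num, padicValRat.of_nat,
        padicValNat_primes hp3, Nat.cast_zero]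
  have P2 : ∀ p : ℕ, p.Prime → p ≠ 2 → Even (padicValRat p (x - 2)) := fun p hp hp2 => by
    haveI := Fact.mk hp
    refine even_padicValRat_sub p (by norm_num) (by norm_num) ?_ ?_ hy hE'
    · rw [show (2 : ℚ) - 1 = 1 by norm_num, padicValRat.one]
    · rw [show (2 : ℚ) - (-2) = ((2 : ℕ) : ℚ) ^ 2 by norm_num, padicValRat.pow,
        padicValRat.of_nat, padicValNat_primes hp2, Nat.cast_zero, mul_zero]
  -- same sign
  have hy2 : 0 < (x - 1) * (x - 2) * (x - (-2)) := by rw [← hE]; positivity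
  have hsign : 0 < (x - 1) * (x - 2) := by
    by_contra hle
    push Not at hle
    rcases le_or_gt (x - (-2)) 0 with h3 | h3
    · have h1 : x - 1 < 0 := by linarith
      have h2 : x - 2 < 0 := by linarith
      nlinarith [mul_pos_of_neg_of_neg h1 h2]
    · nlinarith
  -- square classes of `|x - 1|`, `|x - 2|`
  obtain ⟨u, hu⟩ := exists_abs_eq_sq_or hx₁ 3 P1
  obtain ⟨v, hv⟩ := exists_abs_eq_sq_or hx₂ 2 P2
  push_cast at hu hv
  have hu0 : u ≠ 0 := by
    rintro rfl
    have : |x - 1| = 0 := by rcases hu with hu | hu <;> rw [hu] <;> ring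
    exact hx₁ (abs_eq_zero.mp this)
  have hv0 : v ≠ 0 := by
    rintro rfl
    have : |x - 2| = 0 := by rcases hv with hv | hv <;> rw [hv] <;> ring
    exact hx₂ (abs_eq_zero.mp this)
  -- anisotropy modulo `3` of the three binary forms that occur
  have H₁ : ∀ a b : ZMod 3, ((1 : ℤ) : ZMod 3) * a ^ 2 + ((1 : ℤ) : ZMod 3) * b ^ 2 = 0 →
      a = 0 ∧ b = 0 := by decide
  have H₂ : ∀ a b : ZMod 3, ((2 : ℤ) : ZMod 3) * a ^ 2 + ((-1 : ℤ) : ZMod 3) * b ^ 2 = 0 →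
      a = 0 ∧ b = 0 := by decide
  have H₃ : ∀ a b : ZMod 3, ((1 : ℤ) : ZMod 3) * a ^ 2 + ((-2 : ℤ) : ZMod 3) * b ^ 2 = 0 →
      a = 0 ∧ b = 0 := by decide
  have hγ₁ : ¬(3 : ℤ) ∣ 1 := by decide
  have hγ₂ : ¬(3 : ℤ) ∣ -1 := by decide
  rcases lt_or_gt_of_ne hx₁ with hneg | hpos
  · -- `x - 1 < 0`, hence `x - 2 < 0`
    have hneg₂ : x - 2 < 0 := by linarith
    rw [abs_of_neg hneg] at hu
    rw [abs_of_neg hneg₂] at hv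
    rcases hu with hu | hu <;> rcases hv with hv | hv
    · -- `(-1, -1)`: `x + 2 = w²`, `w² + u² = 3`
      exfalso
      have hy' : y ^ 2 = u ^ 2 * v ^ 2 * (x - (-2)) := by
        rw [hE, show x - 1 = -u ^ 2 by linarith, show x - 2 = -v ^ 2 by linarith]; ring
      have hw : x - (-2) = (y / (u * v)) ^ 2 := by
        field_simp
        linear_combination -hy'
      have key := eq_zero_of_sq_descent_rat H₁ hγ₁ (a := y / (u * v)) (b := u) (c := 1)
        (by push_cast; linarith)
      exact one_ne_zero key.2.2
    · -- `(-1, -2)`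
      exact ⟨u, v, hu0, hv0, Or.inr (Or.inr (Or.inl ⟨by linarith, by linarith⟩))⟩
    · -- `(-3, -1)`
      exact ⟨u, v, hu0, hv0, Or.inr (Or.inl ⟨by linarith, by linarith⟩)⟩
    · -- `(-3, -2)`: `x + 2 = 6w²`, `3w² + v² = 2`
      exfalso
      have hy' : y ^ 2 = 6 * u ^ 2 * v ^ 2 * (x - (-2)) := by
        rw [hE, show x - 1 = -(3 * u ^ 2) by linarith, show x - 2 = -(2 * v ^ 2) by linarith]
        ring
      have hw : x - (-2) = 6 * (y / (6 * u * v)) ^ 2 := by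
        field_simp
        linear_combination -hy'
      have key := eq_zero_of_sq_descent_rat H₃ hγ₂ (a := v) (b := 1) (c := y / (6 * u * v))
        (by push_cast; linarith)
      exact one_ne_zero key.2.1
  · -- `x - 1 > 0`, hence `x - 2 > 0`
    have hpos₂ : 0 < x - 2 := by
      by_contra hh
      push Not at hh
      nlinarith
    rw [abs_of_pos hpos] at hu
    rw [abs_of_pos hpos₂] at hv
    rcases hu with hu | hu <;> rcases hv with hv | hv
    · exact ⟨u, v, hu0, hv0, Or.inl ⟨hu, hv⟩⟩
    · -- `(1, 2)`: `x + 2 = 2w²`, `2w² - u² = 3`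
      exfalso
      have hy' : y ^ 2 = 2 * u ^ 2 * v ^ 2 * (x - (-2)) := by rw [hE, hu, hv]; ring
      have hw : x - (-2) = 2 * (y / (2 * u * v)) ^ 2 := by
        field_simp
        linear_combination -hy'
      have key := eq_zero_of_sq_descent_rat H₂ hγ₁ (a := y / (2 * u * v)) (b := u) (c := 1)
        (by push_cast; linarith)
      exact one_ne_zero key.2.2
    · -- `(3, 1)`: `3u² - v² = 1`, `v² + 1 = 3u²`
      exfalso
      have key := eq_zero_of_sq_descent_rat H₁ hγ₁ (a := v) (b := 1) (c := u)
        (by push_cast; linarith)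
      exact one_ne_zero key.2.1
    · exact ⟨u, v, hu0, hv0, Or.inr (Or.inr (Or.inr ⟨hu, hv⟩))⟩

/-- The square class of `g t²` is that of `g` (`t ≠ 0`). [folklore] -/
theorem sqClass_mul_sq {g t : ℚ} (hg : g ≠ 0) (ht : t ≠ 0) : sqClass (g * t ^ 2) = sqClass g := by
  rw [sqClass_mul hg (pow_ne_zero 2 ht), sqClass_sq, SqUnits.mul_one]

/-- **The image of the complete `2`-descent on `24A1`** (Silverman, *AEC*, Prop. X.1.4 and
Example X.1.5): for every rational point `P`, the pair of descent components
`(δ₁(P), δ₂(P)) = (x - 1, x - 2) ∈ ℚˣ/ℚˣ² × ℚˣ/ℚˣ²` (with the conventions at `O, T₁, T₂`) is one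
of the four classes `(1, 1), (-3, -1), (-1, -2), (3, 2)` — the images of the torsion points
`O` and `(2, 0)`, of `(1, 0)` and `(-2, 0)`, of `(0, ±2)`, of `(4, ±6)`. Proof: direct evaluation
at `O` and at the `2`-torsion points, and `exists_eq_mul_sq_of_equation` at the other points.
Polymorphic in the (mathematically irrelevant) `DecidableEq ℚ` argument of the tree's
`twoDescentComponent`. [cite: SilvermanAEC2009, Prop. X.1.4 and Example X.1.5] -/
theorem descentPair_mem [DecidableEq ℚ] (P : curve24A1.toAffine.Point) :
    (twoDescentComponent curve24A1.toAffine 1 2 (-2) P,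
      twoDescentComponent curve24A1.toAffine 2 1 (-2) P) ∈
      ({(1, 1), (sqClass (-3), sqClass (-1)), (sqClass (-1), sqClass (-2)),
        (sqClass 3, sqClass 2)} : Set (SqUnits ℚ × SqUnits ℚ)) := by
  simp only [Set.mem_insert_iff, Set.mem_singleton_iff, Prod.mk.injEq]
  rcases P with _ | ⟨x, y, hP⟩
  · exact Or.inl ⟨rfl, rfl⟩
  · by_cases hx1 : x = 1
    · subst hx1
      refine Or.inr (Or.inl ⟨?_, ?_⟩)
      · rw [twoDescentComponent_some_of_eq hP rfl]
        norm_num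
      · rw [twoDescentComponent_some_of_ne hP (by norm_num)]
        norm_num
    by_cases hx2 : x = 2
    · subst hx2
      refine Or.inl ⟨?_, ?_⟩
      · rw [twoDescentComponent_some_of_ne hP (by norm_num), show (2 : ℚ) - 1 = 1 ^ 2 by norm_num,
          sqClass_sq]
      · rw [twoDescentComponent_some_of_eq hP rfl,
          show ((2 : ℚ) - 1) * (2 - (-2)) = 2 ^ 2 by norm_num, sqClass_sq]
    by_cases hx3 : x = -2
    · subst hx3
      refine Or.inr (Or.inl ⟨?_, ?_⟩)
      · rw [twoDescentComponent_some_of_ne hP (by norm_num)]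
        norm_num
      · rw [twoDescentComponent_some_of_ne hP (by norm_num),
          show (-2 : ℚ) - 2 = -1 * 2 ^ 2 by norm_num, sqClass_mul_sq (by norm_num) two_ne_zero]
    have hy : y ≠ 0 := fun hy => by
      rcases x_eq_of_y_eq_zero hP.1 hy with h | h | h
      · exact hx1 h
      · exact hx2 h
      · exact hx3 h
    obtain ⟨u, v, hu, hv, hcases⟩ := exists_eq_mul_sq_of_equation hP.1 hy
    rw [twoDescentComponent_some_of_ne hP hx1, twoDescentComponent_some_of_ne hP hx2]
    rcases hcases with ⟨h1, h2⟩ | ⟨h1, h2⟩ | ⟨h1, h2⟩ | ⟨h1, h2⟩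
    · refine Or.inl ⟨?_, ?_⟩
      · rw [h1, sqClass_sq]
      · rw [h2, sqClass_sq]
    · refine Or.inr (Or.inl ⟨?_, ?_⟩)
      · rw [h1, sqClass_mul_sq (by norm_num) hu]
      · rw [h2, show -v ^ 2 = -1 * v ^ 2 by ring, sqClass_mul_sq (by norm_num) hv]
    · refine Or.inr (Or.inr (Or.inl ⟨?_, ?_⟩))
      · rw [h1, show -u ^ 2 = -1 * u ^ 2 by ring, sqClass_mul_sq (by norm_num) hu]
      · rw [h2, sqClass_mul_sq (by norm_num) hv]
    · refine Or.inr (Or.inr (Or.inr ⟨?_, ?_⟩))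
      · rw [h1, sqClass_mul_sq (by norm_num) hu]
      · rw [h2, sqClass_mul_sq (by norm_num) hv]

/-! ### Rank zero: `E(ℚ)` is finite -/

/-- **`2 · (0, 2) = (2, 0)` on `24A1`** (chord-and-tangent: tangent slope `-1` at `(0, 2)`), so
that `(0, ±2)` are points of order `4` (Cremona, Table 1, `24A1`: `|T| = 8`,
`T ≅ ℤ/2ℤ × ℤ/4ℤ`). Polymorphic in the `DecidableEq ℚ` instance behind Mathlib's group law.
[cite: CremonaAlgorithms1997, Table 1, N = 24, curve A1] -/
theorem add_self_zero_two [DecidableEq ℚ] (hQ : curve24A1.toAffine.Nonsingular 0 2)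
    (hT : curve24A1.toAffine.Nonsingular 2 0) :
    (Point.some 0 2 hQ : curve24A1.toAffine.Point) + Point.some 0 2 hQ = Point.some 2 0 hT := by
  have hy : (2 : ℚ) ≠ curve24A1.toAffine.negY 0 2 := by norm_num [negY, curve24A1]
  rw [add_self_of_Y_ne hy]
  congr 1
  · rw [slope_of_Y_ne rfl hy]
    norm_num [addX, negY, curve24A1]
  · rw [slope_of_Y_ne rfl hy]
    norm_num [addY, negAddY, addX, negY, curve24A1]

/-- **`24A1` has Mordell–Weil rank `0`: `E(ℚ)` is finite** (Cremona, *Algorithms for Modular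
Elliptic Curves*, Table 1, `N = 24`, curve `A1`: `r = 0`), proved by the complete `2`-descent
(Silverman, *AEC*, Prop. X.1.4, Example X.1.5): the `2`-descent map `δ` (tree `twoDescentMap`,
kernel `2E(ℚ)`) takes at most the `4` values of `descentPair_mem`, while by the counting lemma
`pow_finrank_add_two_le_natCard_range` (with the torsion points `T₁ = (1, 0)` and `Q = (0, 2)`,
`2Q = (2, 0)`, which `δ` separates: `δ(T₁) = (-3, -1)`, `δ(Q) = (-1, -2)`, `δ(T₁ + Q) = (3, 2)`,
none trivial as `-1` and `2` are not rational squares) it takes at least `2^(r + 2)` values,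
`r = rank_ℤ E(ℚ)` (Mordell–Weil, tree `module_finite_point_holds`); so `r = 0` and `E(ℚ)`, a
finitely generated group of rank `0`, is finite (`finite_point_of_mordellWeilRank_eq_zero`).
[cite: CremonaAlgorithms1997, Table 1, N = 24, curve A1 (r = 0)] -/
theorem finite_point : Finite curve24A1.toAffine.Point := by
  letI := Classical.decEq ℚ
  haveI : curve24A1.IsElliptic := isElliptic_curve24A1
  haveI : Module.Finite ℤ curve24A1.toAffine.Point :=
    WeierstrassCurve.module_finite_point_holds (W := curve24A1)
  have h := splitTwoTorsion
  set ψ := twoDescentMap h with hψ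
  -- the torsion points `T₁ = (1, 0)`, `Q = (0, 2)`, `T₂ = (2, 0) = 2Q`
  have hns : ∀ {a b : ℚ}, curve24A1.toAffine.Equation a b → curve24A1.toAffine.Nonsingular a b :=
    fun hab => equation_iff_nonsingular.mp hab
  have hT₁ : curve24A1.toAffine.Nonsingular 1 0 :=
    hns ((equation_curve24A1_iff 1 0).mpr (by norm_num))
  have hT₂ : curve24A1.toAffine.Nonsingular 2 0 :=
    hns ((equation_curve24A1_iff 2 0).mpr (by norm_num))
  have hQ : curve24A1.toAffine.Nonsingular 0 2 :=
    hns ((equation_curve24A1_iff 0 2).mpr (by norm_num))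
  set T₁ : curve24A1.toAffine.Point := .some 1 0 hT₁ with hT₁def
  set Q : curve24A1.toAffine.Point := .some 0 2 hQ with hQdef
  have h12 : (1 : ℚ) ≠ 2 := by norm_num
  have h01 : (0 : ℚ) ≠ 1 := by norm_num
  have h02 : (0 : ℚ) ≠ 2 := by norm_num
  -- `-1` and `2` are not squares
  have hm1 : sqClass (-1 : ℚ) ≠ 1 := fun h1 => by
    obtain ⟨u, hu⟩ := (sqClass_eq_one_iff (by norm_num)).mp h1
    nlinarith [sq_nonneg u]
  have h2sq : sqClass (2 : ℚ) ≠ 1 := fun h1 => by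
    obtain ⟨u, hu⟩ := (sqClass_eq_one_iff two_ne_zero).mp h1
    exact two_ne_sq u hu
  -- values of `ψ`
  have hψT₁ : ψ T₁ = Additive.ofMul (sqClass ((1 - 2) * (1 - (-2))), sqClass (1 - 2)) := by
    rw [hψ, twoDescentMap_apply, twoDescentComponent_some_of_eq hT₁ rfl,
      twoDescentComponent_some_of_ne hT₁ h12]
  have hψQ : ψ Q = Additive.ofMul (sqClass (0 - 1), sqClass (0 - 2)) := by
    rw [hψ, twoDescentMap_apply, twoDescentComponent_some_of_ne hQ h01,
      twoDescentComponent_some_of_ne hQ h02]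
  have h₁ : ψ T₁ ≠ 0 := by
    rw [hψT₁, Ne, ofMul_eq_zero, Prod.mk_eq_one, not_and_or]
    exact Or.inr (by norm_num; exact hm1)
  have h₂ : ψ Q ≠ 0 := by
    rw [hψQ, Ne, ofMul_eq_zero, Prod.mk_eq_one, not_and_or]
    exact Or.inl (by norm_num; exact hm1)
  have h₃ : ψ (T₁ + Q) ≠ 0 := by
    rw [map_add, hψT₁, hψQ, ← ofMul_mul, Prod.mk_mul_mk, Ne, ofMul_eq_zero, Prod.mk_eq_one,
      not_and_or]
    refine Or.inr ?_
    rw [← sqClass_mul (by norm_num) (by norm_num)]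
    norm_num
    exact h2sq
  have h₁₂ : ψ T₁ ≠ ψ Q := by
    rw [hψT₁, hψQ, Ne, Additive.ofMul.apply_eq_iff_eq, Prod.mk.injEq, not_and_or]
    refine Or.inr fun heq => h2sq ?_
    have key : sqClass ((1 : ℚ) - 2) * sqClass (0 - 2) = 1 := by rw [heq, SqUnits.mul_self]
    rw [← sqClass_mul (by norm_num) (by norm_num)] at key
    norm_num at key
    exact key
  -- the kernel of `ψ` is `2E(ℚ)`
  have hker : ∀ a, ψ a = 0 → ∃ b, a = 2 • b := fun a ha => by
    have ha' : a ∈ ψ.ker := ha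
    rw [hψ, ker_twoDescentMap h] at ha'
    obtain ⟨b, hb⟩ := ha'
    exact ⟨b, hb.symm⟩
  -- finite order of `T₁` and `Q`
  have hfin₁ : IsOfFinAddOrder T₁ := by
    refine isOfFinAddOrder_iff_nsmul_eq_zero.mpr ⟨2, two_pos, ?_⟩
    rw [two_nsmul, hT₁def]
    exact add_self_of_Y_eq (by norm_num [negY, curve24A1])
  have hfin₂ : IsOfFinAddOrder Q := by
    refine isOfFinAddOrder_iff_nsmul_eq_zero.mpr ⟨4, by norm_num, ?_⟩
    rw [show 4 • Q = 2 • (Q + Q) by rw [← two_nsmul, ← mul_nsmul'], hQdef,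
      add_self_zero_two hQ hT₂, two_nsmul]
    exact add_self_of_Y_eq (by norm_num [negY, curve24A1])
  -- the range of `ψ` has at most `4` elements
  set S : Set (SqUnits ℚ × SqUnits ℚ) := {(1, 1), (sqClass (-3), sqClass (-1)),
    (sqClass (-1), sqClass (-2)), (sqClass 3, sqClass 2)} with hS
  have hSfin : S.Finite := (((Set.finite_singleton _).insert _).insert _).insert _
  have hS4 : S.ncard ≤ 4 := by
    rw [hS]
    refine (Set.ncard_insert_le _ _).trans ?_
    refine (Nat.add_le_add_right (Set.ncard_insert_le _ _) 1).trans ?_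
    refine (Nat.add_le_add_right (Nat.add_le_add_right (Set.ncard_insert_le _ _) 1) 1).trans ?_
    rw [Set.ncard_singleton]
  have hsub : Set.range ψ ⊆ Additive.ofMul '' S := by
    rintro _ ⟨P, rfl⟩
    exact ⟨_, descentPair_mem P, by rw [hψ]; exact (twoDescentMap_apply h P).symm⟩
  have hTfin : (Additive.ofMul '' S).Finite := hSfin.image _
  haveI : Finite ψ.range := (hTfin.subset (by rw [AddMonoidHom.coe_range]; exact hsub)).to_subtype
  have hcard : Nat.card ψ.range ≤ 4 := by
    rw [← SetLike.coe_sort_coe, Nat.card_coe_set_eq, AddMonoidHom.coe_range]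
    calc (Set.range ψ).ncard ≤ (Additive.ofMul '' S).ncard := Set.ncard_le_ncard hsub hTfin
      _ ≤ S.ncard := Set.ncard_image_le hSfin
      _ ≤ 4 := hS4
  -- counting: `2 ^ (r + 2) ≤ 4`
  have hbound := pow_finrank_add_two_le_natCard_range ψ hker hfin₁ hfin₂ h₁ h₂ h₃ h₁₂
  have hr : curve24A1.mordellWeilRank = 0 := by
    have hle : 2 ^ (Module.finrank ℤ curve24A1.toAffine.Point + 2) ≤ 2 ^ 2 := hbound.trans hcard
    have := (Nat.pow_le_pow_iff_right (by norm_num)).mp hle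
    unfold WeierstrassCurve.mordellWeilRank
    omega
  exact WeierstrassCurve.finite_point_of_mordellWeilRank_eq_zero curve24A1 hr

end Curve24A1

end Literature.NumberTheory.EllipticCurves

end
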